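import Literature.Computability.Cryptography.HallgrenGiantStepBounds
import Literature.Computability.Cryptography.InfrastructurePrimitivesFP
import Literature.Computability.Complexity.CodeFPLog
import HarnessLib

/-!
# Fixed-point evaluation of the distance correction of Hallgren's giant step, I: accuracy

Topic `Computability/Cryptography`; continues `HallgrenGiantStep.lean` / `HallgrenGiantStepBounds.lean`
(`kappaQ a b = log|reduceMult c| + log(Q_aQ_b/2dQ_c) + log φ_a + log φ_b − log φ_{a*b}`,
`c = comp a b`) with the dyadic logarithms of `CodeFPLog.lean` (`lnDyadicZ`, `lnQuadDyadic`).
Jozsa 2003, §9 Thm. 5: the distances of the giant steps are computed "to sufficient accuracy" in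
polynomial time; here the INTEGER evaluator and its accuracy (the `CodeFP` programs are part II).
Theorem-and-definition file, no named facts.

* `lnValI D p (P, Q) = lnQuadDyadic P Q D p p` (`≈ 2ᵖ log φ` on reduced labels, error `2`);
* `lnAbsLinI D p P ≈ 2ᵖ log|P + √D|` for any integer `P` (negative `P` through
  `|P + √D| = |D − P²|/(−P + √D)`, `log_abs_add_sqrt_of_neg`), error `3`;
* `lnFactorI D p y ≈ 2ᵖ log|gaussFactor y|` (error `4`), `lnMultI D p c F = Σ_{k<F} lnFactorI (ρ_G^k c)`
  and **`abs_log_reduceMult_sub_le`**: for `F ≥ gaussSteps c`, `|log|reduceMult c| − lnMultI/2ᵖ| ≤ 4F/2ᵖ`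
  (`log|gaussMult K x| = Σ_{k<K} log|gaussFactor (ρ_G^k x)|`, and the factors are `1` from `K` on);
* `kappaI D p F a b` and **`abs_kappaQ_sub_kappaI_le`**: on cycle elements,
  `|kappaQ a b − kappaI/2ᵖ| ≤ (4F + 7)/2ᵖ` for any `F ≥ ⌊log₂ D⌋ + 5`.

## References

* R. Jozsa, arXiv:quant-ph/0302134 (2003), §9 Thm. 5, §7.2. [Jozsa2003]
* D. E. Knuth, TAOCP vol. 2, §4.3.1 (fixed-point logarithms). [KnuthTAOCP2]
-/

noncomputable section

open scoped Classical

namespace Literature.Computability.Cryptography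

namespace HallgrenGiantStep

open Literature.NumberTheory.QuadraticFields Literature.NumberTheory.QuadraticFields.QuadIrr HallgrenComposition
  InfraPrimitives Literature.Computability.Complexity.LogFP Finset

variable {D : ℕ}

/-! ### Logarithms of quotient values and of `|P + √D|` -/

/-- `2ᵖ log φ` for a label `(P, Q)` with `P, Q ≥ 1`. [cite: Jozsa2003, §9 Thm. 5] -/
def lnValI (D p : ℕ) (y : ℤ × ℤ) : ℤ := lnQuadDyadic y.1.toNat y.2.toNat D p p

/-- **Accuracy of `lnValI`** on `P ≥ 0`, `Q ≥ 1`: error `≤ 2/2ᵖ`. [cite: Jozsa2003, §9 Thm. 5] -/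
theorem abs_log_val_sub_lnValI_le (hD1 : 1 ≤ D) {x : QuadIrr D} (hP : 0 ≤ x.P) (hQ : 1 ≤ x.Q) (p : ℕ) :
    |Real.log x.val - (lnValI D p (pr x) : ℝ) / 2 ^ p| ≤ 2 / (2 : ℝ) ^ p := by
  have h := abs_log_quad_sub_lnQuadDyadic_le (P := x.P.toNat) (Q := x.Q.toNat) (D := D)
    (by have := Int.toNat_of_nonneg (show 0 ≤ x.Q by omega); omega) hD1 p p
  have hPc : ((x.P.toNat : ℕ) : ℝ) = (x.P : ℝ) := by
    have := Int.toNat_of_nonneg hP; exact_mod_cast this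
  have hQc : ((x.Q.toNat : ℕ) : ℝ) = (x.Q : ℝ) := by
    have := Int.toNat_of_nonneg (show 0 ≤ x.Q by omega); exact_mod_cast this
  rw [hPc, hQc] at h
  have h2 : 1 / (2 : ℝ) ^ p + 1 / (2 : ℝ) ^ p = 2 / (2 : ℝ) ^ p := by ring
  rw [h2] at h
  exact h

/-- **`|P + √D| = |D − P²| / (−P + √D)`** for `P < 0`. [folklore] -/
theorem abs_add_sqrt_of_neg {P : ℤ} (hP : P < 0) :
    |(P : ℝ) + Real.sqrt D| = |((D : ℝ) - (P : ℝ) ^ 2)| / (-(P : ℝ) + Real.sqrt D) := by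
  have hsq : Real.sqrt D ^ 2 = D := Real.sq_sqrt (Nat.cast_nonneg _)
  have hpos : 0 < -(P : ℝ) + Real.sqrt D := by
    have : (P : ℝ) < 0 := by exact_mod_cast hP
    have := Real.sqrt_nonneg (D : ℝ); linarith
  have hprod : ((P : ℝ) + Real.sqrt D) * (-(P : ℝ) + Real.sqrt D) = (D : ℝ) - (P : ℝ) ^ 2 := by
    linear_combination hsq
  rw [eq_div_iff hpos.ne', ← abs_of_pos hpos, ← abs_mul, hprod]

/-- `2ᵖ log|P + √D|` for any integer `P`. [cite: Jozsa2003, §9 Thm. 5] -/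
def lnAbsLinI (D p : ℕ) (P : ℤ) : ℤ :=
  if 0 ≤ P then lnQuadDyadic P.toNat 1 D p p
  else lnDyadicZ ((D : ℤ) - P ^ 2).natAbs 1 p - lnQuadDyadic (-P).toNat 1 D p p

/-- **Accuracy of `lnAbsLinI`**: error `≤ 3/2ᵖ`. [cite: Jozsa2003, §9 Thm. 5] -/
theorem abs_log_abs_lin_sub_le (hD : ¬ IsSquare D) (P : ℤ) (p : ℕ) :
    |Real.log |(P : ℝ) + Real.sqrt D| - (lnAbsLinI D p P : ℝ) / 2 ^ p| ≤ 3 / (2 : ℝ) ^ p := by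
  have hD1 : 1 ≤ D := Nat.one_le_iff_ne_zero.mpr fun h0 => hD (h0 ▸ ⟨0, rfl⟩)
  have h2p : (0 : ℝ) < (2 : ℝ) ^ p := by positivity
  have hε : (0 : ℝ) ≤ ((2 : ℝ) ^ p)⁻¹ := by positivity
  unfold lnAbsLinI
  split_ifs with hP
  · have h := abs_log_quad_sub_lnQuadDyadic_le (P := P.toNat) (Q := 1) (D := D) le_rfl hD1 p p
    have hPc : ((P.toNat : ℕ) : ℝ) = (P : ℝ) := by have := Int.toNat_of_nonneg hP; exact_mod_cast this
    rw [hPc, Nat.cast_one, div_one] at h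
    have hpos : 0 < (P : ℝ) + Real.sqrt D := by
      have : (0 : ℝ) ≤ P := by exact_mod_cast hP
      have : 0 < Real.sqrt D := Real.sqrt_pos.mpr (by exact_mod_cast hD1)
      linarith
    rw [abs_of_pos hpos]
    refine h.trans ?_
    rw [← add_div]
    exact div_le_div_of_nonneg_right (by norm_num) h2p.le
  · push Not at hP
    rw [abs_add_sqrt_of_neg hP]
    have hne : ((D : ℤ) - P ^ 2 : ℤ) ≠ 0 := by
      intro h0
      apply hD
      refine ⟨P.natAbs, ?_⟩
      have h' : ((P.natAbs * P.natAbs : ℕ) : ℤ) = (D : ℤ) := by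
        push_cast; rw [← sq, sq_abs]; linarith
      exact_mod_cast h'.symm
    have hnum : (1 : ℕ) ≤ ((D : ℤ) - P ^ 2).natAbs := Int.natAbs_pos.mpr hne
    have hden : 0 < -(P : ℝ) + Real.sqrt D := by
      have : (P : ℝ) < 0 := by exact_mod_cast hP
      have := Real.sqrt_nonneg (D : ℝ); linarith
    have hneR : (D : ℝ) - (P : ℝ) ^ 2 ≠ 0 := by
      have : (((D : ℤ) - P ^ 2 : ℤ) : ℝ) ≠ 0 := by exact_mod_cast hne
      push_cast at this; exact this
    have hnumR : (0 : ℝ) < |(D : ℝ) - (P : ℝ) ^ 2| := abs_pos.mpr hneR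
    rw [Real.log_div hnumR.ne' hden.ne']
    -- the two dyadic logarithms
    have hA := abs_log_div_sub_lnDyadicZ_le hnum le_rfl p
    have hAc : ((((D : ℤ) - P ^ 2).natAbs : ℕ) : ℝ) = |(D : ℝ) - (P : ℝ) ^ 2| := by
      rw [Nat.cast_natAbs, Int.cast_abs]; push_cast; rfl
    rw [hAc, Nat.cast_one, div_one] at hA
    have hB := abs_log_quad_sub_lnQuadDyadic_le (P := (-P).toNat) (Q := 1) (D := D) le_rfl hD1 p p
    have hBc : (((-P).toNat : ℕ) : ℝ) = -(P : ℝ) := by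
      have h' : (((-P).toNat : ℕ) : ℤ) = -P := Int.toNat_of_nonneg (by omega)
      have h'' : (((-P).toNat : ℕ) : ℝ) = (((-P : ℤ)) : ℝ) := by exact_mod_cast congrArg (fun z : ℤ => (z : ℝ)) h'
      rw [h'']; push_cast; ring
    rw [hBc, Nat.cast_one, div_one] at hB
    simp only [div_eq_mul_inv, one_mul] at hA hB ⊢
    rw [abs_le] at hA hB ⊢
    push_cast
    simp only [sub_mul]
    constructor <;> linarith [hA.1, hA.2, hB.1, hB.2]

/-! ### The Gauss factors -/

/-- `2ᵖ log|gaussFactor y|` on integer data: `0` if `Q² < D`, else `log|P' + √D| − log|Q'|` for the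
raw Gauss step `(P', Q')`. [cite: Jozsa2003, §6.2 Prop. 21] -/
def lnFactorI (D p : ℕ) (y : ℤ × ℤ) : ℤ :=
  if y.2 ^ 2 < (D : ℤ) then 0
  else lnAbsLinI D p (stepWithI D y ((2 * y.1 + y.2) / (2 * y.2))).1 -
    lnDyadicZ (stepWithI D y ((2 * y.1 + y.2) / (2 * y.2))).2.natAbs 1 p

/-- **Accuracy of `lnFactorI`** on admissible data with `Q > 0`: error `≤ 4/2ᵖ`. [cite: Jozsa2003, §9 Thm. 5] -/
theorem abs_log_gaussFactor_sub_le (hD : ¬ IsSquare D) {y : QuadIrr D} (h : y.IsAdmissible) (p : ℕ) :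
    |Real.log |gaussFactor y| - (lnFactorI D p (pr y) : ℝ) / 2 ^ p| ≤ 4 / (2 : ℝ) ^ p := by
  have h2p : (0 : ℝ) < (2 : ℝ) ^ p := by positivity
  unfold lnFactorI gaussFactor
  simp only [show (pr y).1 = y.P from rfl, show (pr y).2 = y.Q from rfl]
  by_cases hlt : y.Q ^ 2 < (D : ℤ)
  · rw [if_pos hlt, if_pos hlt]
    simp only [abs_one, Real.log_one, Int.cast_zero, zero_div, sub_zero, abs_zero]
    positivity
  · rw [if_neg hlt, if_neg hlt]
    have hraw : stepWithI D (pr y) ((2 * y.P + y.Q) / (2 * y.Q)) = pr (gaussRaw y) := rfl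
    rw [hraw]
    simp only [show (pr (gaussRaw y)).1 = (gaussRaw y).P from rfl, show (pr (gaussRaw y)).2 = (gaussRaw y).Q from rfl]
    set r := gaussRaw y with hr
    have hval : r.val = ((r.P : ℝ) + Real.sqrt D) / r.Q := rfl
    have hv0 : r.val ≠ 0 := val_stepWith_ne_zero hD h _
    have hQ0 : r.Q ≠ 0 := by
      intro h0; apply hv0; rw [hval, h0]; simp
    have hQR : (r.Q : ℝ) ≠ 0 := by exact_mod_cast hQ0
    rw [hval, abs_div, Real.log_div (by
        intro h0; apply hv0; rw [hval]; rw [abs_eq_zero] at h0; rw [h0]; simp) (abs_ne_zero.mpr hQR)]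
    have hA := abs_log_abs_lin_sub_le hD r.P p
    have hB := abs_log_div_sub_lnDyadicZ_le (Int.natAbs_pos.mpr hQ0) le_rfl p
    have hBc : ((r.Q.natAbs : ℕ) : ℝ) = |(r.Q : ℝ)| := by rw [Nat.cast_natAbs, Int.cast_abs]
    rw [hBc, Nat.cast_one, div_one] at hB
    simp only [div_eq_mul_inv, one_mul] at hA hB ⊢
    rw [abs_le] at hA hB ⊢
    push_cast
    simp only [sub_mul]
    constructor <;> linarith [hA.1, hA.2, hB.1, hB.2]

/-- `2ᵖ log|gaussMult|` with fuel `F`: the sum of the factor logarithms along the (guarded) Gauss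
iteration `gStepI`, as a list sum (the shape of the program). [cite: Jozsa2003, §6.2 Prop. 21] -/
def lnMultI (D p : ℕ) (c : ℤ × ℤ) (F : ℕ) : ℤ := ((List.range F).map fun k => lnFactorI D p ((gStepI D)^[k] c)).sum

/-- List sums over `range` are `Finset` sums. [folklore] -/
theorem sum_map_range_eq {β : Type*} [AddCommMonoid β] (f : ℕ → β) :
    ∀ F : ℕ, ((List.range F).map f).sum = ∑ k ∈ range F, f k
  | 0 => by simp
  | F + 1 => by rw [List.range_succ, List.map_append, List.sum_append, sum_map_range_eq f F, sum_range_succ]; simp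

/-- On good data the guarded iteration is the Gauss iteration. [folklore] -/
theorem lnMultI_eq_sum (hD : ¬ IsSquare D) {c : QuadIrr D} (h : c.IsAdmissible) (hQ : 0 < c.Q) (p F : ℕ) :
    lnMultI D p (pr c) F = ∑ k ∈ range F, lnFactorI D p ((gaussStepI D)^[k] (pr c)) := by
  unfold lnMultI
  rw [sum_map_range_eq]
  refine sum_congr rfl fun k _ => ?_
  rw [gStepI_iterate, if_pos ((good_pr_iff c).mpr ⟨hD, h, hQ⟩)]

/-- `log|gaussMult K x| = Σ_{k<K} log|gaussFactor (ρ_Gᵏ x)|`. [cite: Jozsa2003, §6.2 Prop. 21] -/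
theorem log_abs_gaussMult (hD : ¬ IsSquare D) :
    ∀ (K : ℕ) {x : QuadIrr D}, x.IsAdmissible → 0 < x.Q →
      Real.log |gaussMult K x| = ∑ k ∈ range K, Real.log |gaussFactor (gaussStep^[k] x)|
  | 0, _, _, _ => by simp [gaussMult]
  | K + 1, x, h, hQ => by
    obtain ⟨h1, h2⟩ := gaussStep_spec hD h hQ
    have hm : gaussMult K (gaussStep x) ≠ 0 := by
      have := le_abs_gaussMult hD K h1 h2
      have h0 : (0 : ℝ) < (1 / 2 : ℝ) ^ K := by positivity
      exact abs_pos.mp (h0.trans_le this)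
    have hf : gaussFactor x ≠ 0 := by
      unfold gaussFactor; split_ifs
      · exact one_ne_zero
      · exact val_stepWith_ne_zero hD h _
    rw [gaussMult, abs_mul, Real.log_mul (abs_ne_zero.mpr hm) (abs_ne_zero.mpr hf), log_abs_gaussMult hD K h1 h2,
      sum_range_succ']
    simp only [Function.iterate_succ_apply, Function.iterate_zero, id_eq]

/-- `Q² < D` is a fixed point of the Gauss step. [folklore] -/
theorem gaussStep_of_lt {y : QuadIrr D} (h : y.Q ^ 2 < (D : ℤ)) : gaussStep y = y := by
  unfold gaussStep; rw [if_pos h]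

/-- Beyond `gaussSteps` the factors are `1`. [cite: JacobsonWilliams2008, §5.1 Thm. 5.9] -/
theorem gaussFactor_iterate_eq_one (hD : ¬ IsSquare D) {x : QuadIrr D} (h : x.IsAdmissible) (hQ : 0 < x.Q) {k : ℕ}
    (hk : gaussSteps x ≤ k) : gaussFactor (gaussStep^[k] x) = 1 := by
  have hlt := gaussIter_Q_sq_lt hD h hQ
  have key : ∀ j, gaussStep^[gaussSteps x + j] x = gaussStep^[gaussSteps x] x := by
    intro j
    induction j with
    | zero => rfl
    | succ j ih => rw [Nat.add_succ, Function.iterate_succ_apply', ih, gaussStep_of_lt hlt]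
  obtain ⟨j, rfl⟩ := Nat.exists_eq_add_of_le hk
  rw [key j]
  unfold gaussFactor; rw [if_pos hlt]

/-- **Accuracy of `lnMultI`**: for fuel `F ≥ gaussSteps c`, `|log|reduceMult c| − lnMultI/2ᵖ| ≤ 4F/2ᵖ`.
[cite: Jozsa2003, §9 Thm. 5] [cite: JacobsonWilliams2008, (5.12), (5.38)] -/
theorem abs_log_reduceMult_sub_le (hD : ¬ IsSquare D) {c : QuadIrr D} (h : c.IsAdmissible) (hQ : 0 < c.Q)
    (p : ℕ) {F : ℕ} (hF : gaussSteps c ≤ F) :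
    |Real.log |reduceMult c| - (lnMultI D p (pr c) F : ℝ) / 2 ^ p| ≤ 4 * F / (2 : ℝ) ^ p := by
  have hsum : Real.log |reduceMult c| = ∑ k ∈ range F, Real.log |gaussFactor (gaussStep^[k] c)| := by
    unfold reduceMult
    rw [log_abs_gaussMult hD _ h hQ]
    obtain ⟨j, rfl⟩ := Nat.exists_eq_add_of_le hF
    rw [sum_range_add]
    have htail : ∑ k ∈ range j, Real.log |gaussFactor (gaussStep^[gaussSteps c + k] c)| = 0 := by
      refine sum_eq_zero fun k _ => ?_
      rw [gaussFactor_iterate_eq_one hD h hQ (Nat.le_add_right _ _)]; simp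
    rw [htail, add_zero]
  rw [hsum, lnMultI_eq_sum hD h hQ]
  push_cast
  rw [sum_div, ← sum_sub_distrib]
  calc |∑ k ∈ range F, (Real.log |gaussFactor (gaussStep^[k] c)| - (lnFactorI D p ((gaussStepI D)^[k] (pr c)) : ℝ) / 2 ^ p)|
      ≤ ∑ k ∈ range F, |Real.log |gaussFactor (gaussStep^[k] c)| - (lnFactorI D p ((gaussStepI D)^[k] (pr c)) : ℝ) / 2 ^ p| :=
        abs_sum_le_sum_abs _ _
    _ ≤ ∑ _k ∈ range F, 4 / (2 : ℝ) ^ p := sum_le_sum fun k _ => by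
        rw [gaussStepI_iterate_pr]
        obtain ⟨h1, h2⟩ := gaussIter_spec hD k h hQ
        exact abs_log_gaussFactor_sub_le hD h1 p
    _ = 4 * F / (2 : ℝ) ^ p := by rw [sum_const, card_range, nsmul_eq_mul]; ring

/-! ### The correction -/

/-- **The integer evaluator of the correction** (`2ᵖ κ`): the sum of factor logarithms of the
composition, the logarithm of the rational factor `Q_aQ_b/(2dQ_c)` (the content `d` supplied), and
the three label logarithms. [cite: Jozsa2003, §7.2, §9 Thm. 5] -/
def kappaI (D p F : ℕ) (d : ℤ) (a b : ℤ × ℤ) : ℤ :=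
  lnMultI D p (compI D a b) F + lnDyadicZ (a.2 * b.2).natAbs (2 * d * (compI D a b).2).natAbs p +
    lnValI D p a + lnValI D p b - lnValI D p (starI D a b)

/-- **Accuracy of the correction evaluator** on elements of the principal cycle:
`|κ(a, b) − kappaI/2ᵖ| ≤ (4F + 7)/2ᵖ` for any fuel `F ≥ ⌊log₂ D⌋ + 5`.
[cite: Jozsa2003, §9 Thm. 5] -/
theorem abs_kappaQ_sub_kappaI_le (hD : ¬ IsSquare D) (hD4 : D % 4 = 0 ∨ D % 4 = 1) (i j p : ℕ) {F : ℕ}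
    (hF : Nat.log 2 D + 5 ≤ F) :
    |kappaQ (step^[i] (principalFirst D)) (step^[j] (principalFirst D)) -
        (kappaI D p F (compScalar (step^[i] (principalFirst D)) (step^[j] (principalFirst D)))
          (pr (step^[i] (principalFirst D))) (pr (step^[j] (principalFirst D))) : ℝ) / 2 ^ p| ≤
      (4 * F + 7) / (2 : ℝ) ^ p := by
  set a := step^[i] (principalFirst D)
  set b := step^[j] (principalFirst D)
  have hD1 : 1 ≤ D := Nat.one_le_iff_ne_zero.mpr fun h0 => hD (h0 ▸ ⟨0, rfl⟩)
  have ha : a.IsIdealShaped := isIdealShaped_cycle hD hD4 i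
  have hb : b.IsIdealShaped := isIdealShaped_cycle hD hD4 j
  have hra : a.IsReduced := isReduced_iterate hD (isReduced_principalFirst hD hD4) i
  have hrb : b.IsReduced := isReduced_iterate hD (isReduced_principalFirst hD hD4) j
  have hcQ : 0 < (comp a b).Q := comp_Q_pos hD4 ha hb
  have hcadm : (comp a b).IsAdmissible := (isIdealShaped_comp hD4 ha hb).isAdmissible
  have hrw : (starQ a b).IsReduced := isReduced_reduce hD hcadm hcQ
  obtain ⟨hQc, -, -⟩ := comp_Q_lt hD hD4 ha hb hra hrb
  have hsteps : gaussSteps (comp a b) ≤ F := (gaussSteps_le hD hcQ hQc.le).trans hF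
  -- integer data agree with the quotients
  have hcI : compI D (pr a) (pr b) = pr (comp a b) := compI_pr a b
  have hsI : starI D (pr a) (pr b) = pr (starQ a b) := by
    unfold starI starQ; rw [hcI, reduceI_pr hD hcadm hcQ]
  -- the five terms
  have h1 := abs_log_reduceMult_sub_le hD hcadm hcQ p hsteps
  have hd := compScalar_pos (y := b) ha
  have hle := two_mul_scalar_mul_Q_le hD hD4 ha hb
  have hnum : 1 ≤ (a.Q * b.Q).natAbs := by
    have : 0 < a.Q * b.Q := mul_pos ha.1 hb.1
    omega
  have hden : 1 ≤ (2 * compScalar a b * (comp a b).Q).natAbs := by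
    have : 0 < 2 * compScalar a b * (comp a b).Q := by positivity
    omega
  have h2 := abs_log_div_sub_lnDyadicZ_le hnum hden p
  have hnumc : (((a.Q * b.Q).natAbs : ℕ) : ℝ) = (a.Q : ℝ) * b.Q := by
    rw [Nat.cast_natAbs, abs_of_nonneg (mul_pos ha.1 hb.1).le]; push_cast; ring
  have hdenc : (((2 * compScalar a b * (comp a b).Q).natAbs : ℕ) : ℝ) = 2 * compScalar a b * (comp a b).Q := by
    rw [Nat.cast_natAbs, abs_of_nonneg (by positivity)]; push_cast; ring
  rw [hnumc, hdenc] at h2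
  have h3 := abs_log_val_sub_lnValI_le hD1 hra.P_pos.le (show 1 ≤ a.Q by have := hra.1; omega) p
  have h4 := abs_log_val_sub_lnValI_le hD1 hrb.P_pos.le (show 1 ≤ b.Q by have := hrb.1; omega) p
  have h5 := abs_log_val_sub_lnValI_le hD1 hrw.P_pos.le (show 1 ≤ (starQ a b).Q by have := hrw.1; omega) p
  -- assemble
  unfold kappaQ kappaI
  rw [hcI, hsI]
  simp only [show (pr a).2 = a.Q from rfl, show (pr b).2 = b.Q from rfl, show (pr (comp a b)).2 = (comp a b).Q from rfl]
  push_cast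
  set B := (4 : ℝ) * F / 2 ^ p with hB
  have hgoal : ((4 : ℝ) * F + 7) / 2 ^ p = B + 7 / 2 ^ p := by rw [hB]; ring
  rw [hgoal]
  simp only [div_eq_mul_inv, sub_mul, add_mul, one_mul] at h1 h2 h3 h4 h5 ⊢
  rw [abs_le] at h1 h2 h3 h4 h5 ⊢
  constructor <;> linarith [h1.1, h1.2, h2.1, h2.2, h3.1, h3.2, h4.1, h4.2, h5.1, h5.2]

end HallgrenGiantStep

end Literature.Computability.Cryptography

end
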